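import Summits.NavierStokesRegularity.NavierStokesRegularity.Theorems.CorkscrewDynamoCorkscrewProfileSkewDriftLiouville
import Summits.NavierStokesRegularity.NavierStokesRegularity.Theorems.CorkscrewDynamoCorkscrewProfileRotatedPressurePoisson
import Summits.NavierStokesRegularity.NavierStokesRegularity.Theorems.CorkscrewDynamoCorkscrewProfileRotatedHeadIdentity
import Summits.NavierStokesRegularity.NavierStokesRegularity.Theorems.CorkscrewDynamoCorkscrewProfileRotatedHeadGrowth
import Summits.NavierStokesRegularity.NavierStokesRegularity.Theorems.CorkscrewDynamoCorkscrewProfileRotatedLaplacianZero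
import Summits.NavierStokesRegularity.NavierStokesRegularity.Theorems.CorkscrewDynamoCorkscrewProfileCorotatingFrame
import Literature.Analysis.FluidPDE.VectorCalculusProofs
import HarnessLib

/-!
# Route CorkscrewDynamo · crux `CorkscrewProfile` (stmt-NavierStokesRegularity-11282) — CO-ROTATION NECESSITY

Line `registered` (= `Cruxes/CorkscrewProfile/Lines/birth.lean`), lead c5 (2026-08-17), assembly of the tool stubs
T1–T5 (landed p167704, p167903, p168213, p168026, p168119) into the registered theorems T6
`rotatedLerayProfile_eq_zero_of_trace_nonneg` and T7 `rotatedLerayProfile_eq_zero_of_counterRotating`, plus corollaries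
in the line's own vocabulary.

THE THEOREM. The line's object is a relative equilibrium of Leray's backward self-similar system in a frame rotating about
`e₃` — a smooth solution `(U, P)` of Perelman's ROTATED LERAY PROFILE SYSTEM
`α(JU − DU[Jy]) + ½U + ½DU[y] − ΔU + DU[U] + ∇P = 0`, `div U = 0`, `J = rotGen = e₃ × ·`
(`relativeEquilibrium_iff_rotatedLerayProfile`, p154163; it implies `RssProfileExists` and hence the crux, p155162/p155081).
For such a profile with the Type-I profile decay `‖U y‖ ≤ C₀/(1+‖y‖)` and bounded pressure we prove:

* (**co-rotation necessity**, `rotatedLerayProfile_eq_zero_of_counterRotating`) if the vertical vorticity never co-rotates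
  with the pattern, `α · (curl U)₃ ≤ 0` on `ℝ³`, then `U ≡ 0`; equivalently a nontrivial profile has `α (curl U)₃ > 0`
  somewhere (`exists_corotating_vorticity_of_ne_zero`); the same in the relative-equilibrium (`e₃ × ·`) vocabulary of the
  v1–v3 stub (`relativeEquilibrium_eq_zero_of_counterRotating`);
* (**co-rotation sphere rigidity**, `rotatedLerayProfile_vorticity_on_corotationSphere`) if the vorticity never enters the
  OPEN co-rotation ball `B(αe₃, |α|)`, i.e. `2α (curl U)₃ ≤ |curl U|²` everywhere, then it lies ON the sphere everywhere:
  `|curl U|² ≡ 2α (curl U)₃`.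

At `α = 0` the first statement is Tsai 1998, Theorem 1 (tree: `IsLerayProfile.eq_zero_of_growth`,
`relativeEquilibrium_eq_zero_of_omega_zero`). For `α ≠ 0` it is, as far as searched (PV 2026 p. 4: "We are not aware … of
any scalar quantity (an α-dependent modification of (1.4)) playing the role of the Bernoulli function, and which satisfies a
maximum principle. This is the central obstruction"; corpus/galaxy searches in NOTES), new: the ROTATION-GAUGED HEAD PRESSURE
`Π_α := P + ½|U|² + ½⟪y, U⟫ − α⟪Jy, U⟫` satisfies the exact identity
`ΔΠ_α − DΠ_α[U + ½y − αJy] = |curl U|² − 2α (curl U)₃ = |curl U − αe₃|² − α²`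
(first kernel-checked, in coordinates, for crux stmt-NavierStokesRegularity-2955 — idea card `rotation-gauged-head`,
`Cruxes/FrequencyRigidity/Ideator1TorqueProof.lean`, unlanded; here `stub_rotatedHeadIdentity`, coordinate-free, any
finite-dimensional inner product space, any skew `A`), so `Π_α` is a polynomially bounded subsolution of a drift–Laplace
operator whose drift has a SKEW LINEAR part; Tsai's Liouville Lemma 5.1 survives such drifts (`stub_skewDriftLiouville`: the
radial Gaussian barriers are blind to them), so `Π_α` is constant, the source vanishes identically, and under the sign
hypothesis `curl U ≡ 0`, `DU` is symmetric, `ΔU ≡ 0` (`stub_rotatedLaplacianZero`) and a harmonic field with Type-I decay is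
zero (`eq_zero_of_harmonic_memLp_inner`).

Consequence for the crux (recorded, not a closure): the relative equilibrium behind any corkscrew of this line has vertical
vorticity STRICTLY co-rotating with the pattern somewhere — indeed its vorticity enters the open ball `B(αe₃, |α|)` somewhere —
a Cowling-type necessary condition complementing `relativeEquilibrium_eq_zero_of_axisymmetric` / `…_of_sphereTangent` /
`…_of_small` / `relativeEquilibrium_rotation_window`.
-/

noncomputable section

open MeasureTheory Set Function Filter Topology InnerProductSpace Metric
open Literature.Analysis.FluidPDE
open scoped RealInnerProductSpace Laplacian ContDiff NNReal ENNReal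

namespace Summit.NavierStokesRegularity.NavierStokesRegularity.Theorems.CorkscrewProfile.Birth

set_option linter.dupNamespace false

section General

variable {E : Type*} [NormedAddCommGroup E] [InnerProductSpace ℝ E] [FiniteDimensional ℝ E]

omit [FiniteDimensional ℝ E] in
/-- The gauged head `Π_A = Π − ⟪A·, U⟫` is `C²` when `U` and `P` are. [folklore] -/
theorem contDiff_rotatedHead {a : ℝ} {U : E → E} {P : E → ℝ} (A : E →L[ℝ] E)
    (hU2 : ContDiff ℝ 2 U) (hP2 : ContDiff ℝ 2 P) :
    ContDiff ℝ 2 (fun z => headPressure a U P z - ⟪A z, U z⟫) :=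
  (contDiff_headPressure hU2 hP2).sub (A.contDiff.inner ℝ hU2)

omit [FiniteDimensional ℝ E] in
/-- A skew operator in the form `⟪A v, w⟫ = −⟪v, A w⟫` has `⟪A v, v⟫ = 0`. [folklore] -/
theorem inner_skew_self_eq_zero (A : E →L[ℝ] E) (hA : ∀ v w : E, ⟪A v, w⟫ = -⟪v, A w⟫) (v : E) :
    ⟪A v, v⟫ = 0 := by
  have h := hA v v
  rw [real_inner_comm (A v) v] at h
  linarith

/-- **The gauged head of a bounded rotated Leray profile with nonnegative source is constant, and then the source vanishes
identically.** General form of the rigidity step: `ν > 0`, `a > 0`, `A` skew, `U ∈ C³` bounded, `P ∈ C²` polynomially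
bounded, `div U = 0`, the rotated profile system, and `0 ≤ (ν/2)|DU − DUᵀ|² + 2ν tr (A ∘ DU)` everywhere; then
`(ν/2)|DU − DUᵀ|² + 2ν tr (A ∘ DU) ≡ 0` and `DΠ_A ≡ 0`. [cite: Tsai1998, Lemma 5.1 and §5 (the case A = 0)] -/
theorem rotatedHead_source_eq_zero_of_nonneg
    {ν a : ℝ} (hν : 0 < ν) (ha : 0 < a) {U : E → E} {P : E → ℝ} (A : E →L[ℝ] E)
    (hA : ∀ v w : E, ⟪A v, w⟫ = -⟪v, A w⟫)
    (hU3 : ContDiff ℝ 3 U) (hP2 : ContDiff ℝ 2 P) (hdiv : VectorCalculus.IsDivFree U)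
    (heq : ∀ y, -(ν • (Δ U) y) + a • U y + a • fderiv ℝ U y y + (A (U y) - fderiv ℝ U y (A y)) +
      convect U U y + gradient P y = 0)
    {M C : ℝ} {N : ℕ} (hUb : ∀ y, ‖U y‖ ≤ M) (hPC : ∀ y, |P y| ≤ C * (1 + ‖y‖) ^ N)
    (hsrc : ∀ y, 0 ≤ ν / 2 * frobeniusNormSq (spin U y) + 2 * ν * traceCLM (A.comp (fderiv ℝ U y))) :
    (∀ y, ν / 2 * frobeniusNormSq (spin U y) + 2 * ν * traceCLM (A.comp (fderiv ℝ U y)) = 0) ∧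
      ∀ y w, fderiv ℝ (fun z => headPressure a U P z - ⟪A z, U z⟫) y w = 0 := by
  have hU2 : ContDiff ℝ 2 U := hU3.of_le (by norm_num)
  have hΘ2 := contDiff_rotatedHead (a := a) (P := P) A hU2 hP2
  have hΔP := stub_rotatedPressurePoisson A hU3 hP2 hdiv heq
  have hid : ∀ y, driftOp ν a (fun z => U z - A z) (fun z => headPressure a U P z - ⟪A z, U z⟫) y =
      ν / 2 * frobeniusNormSq (spin U y) + 2 * ν * traceCLM (A.comp (fderiv ℝ U y)) :=
    fun y => stub_rotatedHeadIdentity A hA hU3 hP2 hdiv heq hΔP y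
  have hsub : ∀ y, 0 ≤ driftOp ν a (fun z => U z - A z) (fun z => headPressure a U P z - ⟪A z, U z⟫) y :=
    fun y => (hsrc y).trans_eq (hid y).symm
  have hM : 0 ≤ M := (norm_nonneg _).trans (hUb 0)
  have hC : 0 ≤ C := by
    have h := hPC 0
    rw [norm_zero, add_zero, one_pow, mul_one] at h
    exact (abs_nonneg _).trans h
  have hgrowth := fun y => stub_rotatedHeadGrowth (a := a) (P := P) A ha.le hM hC hUb hPC y
  have hUaff : ∀ y, ‖U y‖ ≤ M + 0 * ‖y‖ := fun y => by rw [zero_mul, add_zero]; exact hUb y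
  have hconst : ∀ x y, (fun z => headPressure a U P z - ⟪A z, U z⟫) x =
      (fun z => headPressure a U P z - ⟪A z, U z⟫) y := fun x y =>
    stub_skewDriftLiouville hν le_rfl ha A (inner_skew_self_eq_zero A hA) hΘ2 hsub hUaff hgrowth x y
  have hfun : (fun z => headPressure a U P z - ⟪A z, U z⟫) =
      fun _ => headPressure a U P 0 - ⟪A 0, U 0⟫ := funext fun x => hconst x 0
  have hD0 : ∀ y w, fderiv ℝ (fun z => headPressure a U P z - ⟪A z, U z⟫) y w = 0 := fun y w => by
    rw [hfun]
    simp
  refine ⟨fun y => ?_, hD0⟩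
  have hzero : driftOp ν a (fun z => U z - A z) (fun z => headPressure a U P z - ⟪A z, U z⟫) y = 0 := by
    rw [driftOp, hD0 y, sub_zero, hfun, laplacian_const_eq_zero, mul_zero]
  rw [← hid y, hzero]

/-- **Assembly T6 `rotatedLerayProfile_eq_zero_of_trace_nonneg` — CO-ROTATION NECESSITY, general form** (registered tool
stub of crux stmt-NavierStokesRegularity-11282, line `registered`). `ν > 0`, `a > 0`, `A` skew, `U ∈ C³` bounded and in some
`L^q` (`1 ≤ q < ∞`), `P ∈ C²` polynomially bounded, `div U = 0`, the rotated Leray profile system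
`−νΔU + aU + aDU[y] + (A U − DU[A y]) + DU[U] + ∇P = 0`, and the sign condition `0 ≤ tr (A ∘ DU)` everywhere (on `ℝ³` with
`A = αJ`: `α (curl U)₃ ≤ 0`) force `U ≡ 0`: the gauged head is a polynomially bounded subsolution
(`stub_rotatedHeadIdentity`, `stub_rotatedPressurePoisson`, `stub_rotatedHeadGrowth`), hence constant
(`stub_skewDriftLiouville`); the source `(ν/2)|DU − DUᵀ|² + 2ν tr (A∘DU)` then vanishes, so `DU` is symmetric and
`ΔU ≡ 0` (`stub_rotatedLaplacianZero`); a harmonic `L^q` field is zero (`eq_zero_of_harmonic_memLp_inner`). The case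
`A = 0` is Tsai 1998, Theorem 1 (`IsLerayProfile.eq_zero_of_growth`). [cite: Tsai1998, Theorem 1 and §5 (the case A = 0)] -/
theorem rotatedLerayProfile_eq_zero_of_trace_nonneg [MeasurableSpace E] [BorelSpace E] [Nontrivial E]
    {ν a : ℝ} (hν : 0 < ν) (ha : 0 < a) {U : E → E} {P : E → ℝ} (A : E →L[ℝ] E)
    (hA : ∀ v w : E, ⟪A v, w⟫ = -⟪v, A w⟫)
    (hU3 : ContDiff ℝ 3 U) (hP2 : ContDiff ℝ 2 P) (hdiv : VectorCalculus.IsDivFree U)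
    (heq : ∀ y, -(ν • (Δ U) y) + a • U y + a • fderiv ℝ U y y + (A (U y) - fderiv ℝ U y (A y)) +
      convect U U y + gradient P y = 0)
    {M C : ℝ} {N : ℕ} (hUb : ∀ y, ‖U y‖ ≤ M) (hPC : ∀ y, |P y| ≤ C * (1 + ‖y‖) ^ N)
    {q : ℝ≥0∞} (hq1 : 1 ≤ q) (hq : q ≠ ⊤) (hUq : MeasureTheory.MemLp U q MeasureTheory.volume)
    (hsign : ∀ y, 0 ≤ traceCLM (A.comp (fderiv ℝ U y))) : U = 0 := by
  have hU2 : ContDiff ℝ 2 U := hU3.of_le (by norm_num)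
  have hsrc : ∀ y, 0 ≤ ν / 2 * frobeniusNormSq (spin U y) + 2 * ν * traceCLM (A.comp (fderiv ℝ U y)) :=
    fun y => add_nonneg (mul_nonneg (by positivity) (frobeniusNormSq_nonneg _))
      (mul_nonneg (by positivity) (hsign y))
  obtain ⟨hzero, hD0⟩ := rotatedHead_source_eq_zero_of_nonneg hν ha A hA hU3 hP2 hdiv heq hUb hPC hsrc
  have hspin : ∀ y, spin U y = 0 := fun y => by
    refine eq_zero_of_frobeniusNormSq_eq_zero ?_
    have h1 := hzero y
    have h2 := frobeniusNormSq_nonneg (spin U y)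
    have h3 := hsign y
    nlinarith
  have hΔ : ∀ y, (Δ U) y = 0 := fun y =>
    stub_rotatedLaplacianZero A hA hν.ne' hU3 hP2 heq (hD0 y) (hspin y)
  exact eq_zero_of_harmonic_memLp_inner (harmonicOnNhd_of_laplacian_eq_zero hU2 hΔ) hq1 hq hUq

end General

/-! ### Specialisation to `ℝ³`: `A = α J`, `J = rotGen = e₃ × ·` -/

section R3

/-- `J = rotGen` is skew: `⟪α J v, w⟫ = −⟪v, α J w⟫`. [folklore] -/
theorem inner_smul_rotGenL_skew (α : ℝ) (v w : EuclideanSpace ℝ (Fin 3)) :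
    ⟪(α • rotGenL) v, w⟫ = -⟪v, (α • rotGenL) w⟫ := by
  simp only [_root_.smul_apply, rotGenL_apply, real_inner_smul_left, real_inner_smul_right]
  rw [real_inner_comm (rotGen w) v, inner_rotGen_left, inner_rotGen_left]
  ring

/-- **The Coriolis source in coordinates**: `tr (J ∘ L) = (L e₁)₀ − (L e₀)₁`; for `L = DU(y)` this is `−(curl U)₃(y)`.
[folklore] -/
theorem traceCLM_rotGenL_comp (L : EuclideanSpace ℝ (Fin 3) →L[ℝ] EuclideanSpace ℝ (Fin 3)) :
    traceCLM (rotGenL.comp L) = L (EuclideanSpace.single 1 1) 0 - L (EuclideanSpace.single 0 1) 1 := by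
  rw [traceCLM_apply, LinearMap.trace_eq_sum_inner _ (EuclideanSpace.basisFun (Fin 3) ℝ)]
  simp only [Fin.sum_univ_three, EuclideanSpace.basisFun_apply, ContinuousLinearMap.coe_coe,
    ContinuousLinearMap.comp_apply, rotGenL_apply, EuclideanSpace.inner_single_left,
    map_one, one_mul, rotGen_apply_zero, rotGen_apply_one, rotGen_apply_two]
  ring

/-- `tr (αJ ∘ DU(y)) = −α (curl U)₃(y)`. [folklore] -/
theorem traceCLM_smul_rotGenL_comp_fderiv (α : ℝ) (U : EuclideanSpace ℝ (Fin 3) → EuclideanSpace ℝ (Fin 3))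
    (y : EuclideanSpace ℝ (Fin 3)) :
    traceCLM ((α • rotGenL).comp (fderiv ℝ U y)) = -(α * curl U y 2) := by
  rw [ContinuousLinearMap.smul_comp, map_smul, smul_eq_mul, traceCLM_rotGenL_comp]
  simp [curl]
  ring

/-- The rotated profile system of the line (`α • (rotGen (U y) − DU (rotGen y)) + ½U + ½DU[y] − ΔU + DU[U] + ∇P = 0`) in
the general form used by the tool stubs (`ν = 1`, `a = ½`, `A = α • rotGenL`). [folklore] -/
theorem rotatedProfile_eq_general {α : ℝ} {U : EuclideanSpace ℝ (Fin 3) → EuclideanSpace ℝ (Fin 3)}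
    {P : EuclideanSpace ℝ (Fin 3) → ℝ}
    (heq : ∀ y : EuclideanSpace ℝ (Fin 3),
      α • (rotGen (U y) - fderiv ℝ U y (rotGen y)) + (1 / 2 : ℝ) • U y + (1 / 2 : ℝ) • fderiv ℝ U y y
        - (Δ U) y + fderiv ℝ U y (U y) + gradient P y = 0)
    (y : EuclideanSpace ℝ (Fin 3)) :
    -((1 : ℝ) • (Δ U) y) + (1 / 2 : ℝ) • U y + (1 / 2 : ℝ) • fderiv ℝ U y y +
      ((α • rotGenL) (U y) - fderiv ℝ U y ((α • rotGenL) y)) + convect U U y + gradient P y = 0 := by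
  rw [← heq y]
  simp only [one_smul, _root_.smul_apply, rotGenL_apply, map_smul, convect_apply]
  module

/-- From the profile Type-I decay `‖U y‖ ≤ C₀/(1+‖y‖)`: `0 ≤ C₀`, `‖U y‖ ≤ C₀`, `‖y‖‖U y‖ ≤ C₀`. [folklore] -/
theorem bounds_of_profile_decay {C₀ : ℝ} {U : EuclideanSpace ℝ (Fin 3) → EuclideanSpace ℝ (Fin 3)}
    (hdec : ∀ y : EuclideanSpace ℝ (Fin 3), ‖U y‖ ≤ C₀ / (1 + ‖y‖)) :
    0 ≤ C₀ ∧ (∀ y, ‖U y‖ ≤ C₀) ∧ ∀ y, ‖y‖ * ‖U y‖ ≤ C₀ := by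
  have hC₀ : 0 ≤ C₀ := by
    have h := hdec 0
    rw [norm_zero, add_zero, div_one] at h
    exact (norm_nonneg _).trans h
  refine ⟨hC₀, fun y => ?_, fun y => ?_⟩
  · have h1 : (0 : ℝ) < 1 + ‖y‖ := by positivity
    exact (hdec y).trans (div_le_self hC₀ (by linarith [norm_nonneg y]))
  · have h1 : (0 : ℝ) < 1 + ‖y‖ := by positivity
    have h2 : (1 + ‖y‖) * ‖U y‖ ≤ C₀ := by
      rw [mul_comm]; exact (le_div_iff₀ h1).1 (hdec y)
    nlinarith [norm_nonneg y, norm_nonneg (U y)]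

/-- **Corollary T7 `rotatedLerayProfile_eq_zero_of_counterRotating` — co-rotation necessity on `ℝ³`, the line's
vocabulary** (registered tool stub of crux stmt-NavierStokesRegularity-11282, line `registered`). A smooth solution of
Perelman's rotated Leray profile system (`ν = 1`, `a = ½`, rotation `α` about `e₃`) with the profile Type-I decay and bounded
pressure, whose vertical vorticity never co-rotates with the pattern (`α (curl U)₃ ≤ 0` on `ℝ³`), is trivial. At `α = 0`
this is Tsai 1998 Thm 1; the relative equilibrium behind any corkscrew of this line therefore has `α (curl U)₃ > 0`
somewhere. [cite: Tsai1998, Theorem 1 (the case α = 0)] -/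
theorem rotatedLerayProfile_eq_zero_of_counterRotating {α C₀ M : ℝ}
    {U : EuclideanSpace ℝ (Fin 3) → EuclideanSpace ℝ (Fin 3)} {P : EuclideanSpace ℝ (Fin 3) → ℝ}
    (hU : ContDiff ℝ (⊤ : ℕ∞) U) (hP : ContDiff ℝ (⊤ : ℕ∞) P) (hdiv : VectorCalculus.IsDivFree U)
    (heq : ∀ y : EuclideanSpace ℝ (Fin 3),
      α • (rotGen (U y) - fderiv ℝ U y (rotGen y)) + (1 / 2 : ℝ) • U y + (1 / 2 : ℝ) • fderiv ℝ U y y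
        - (Δ U) y + fderiv ℝ U y (U y) + gradient P y = 0)
    (hdec : ∀ y : EuclideanSpace ℝ (Fin 3), ‖U y‖ ≤ C₀ / (1 + ‖y‖))
    (hPM : ∀ y : EuclideanSpace ℝ (Fin 3), |P y| ≤ M)
    (hsign : ∀ y : EuclideanSpace ℝ (Fin 3), α * (curl U y) 2 ≤ 0) : U = 0 := by
  obtain ⟨-, hUb, hyU⟩ := bounds_of_profile_decay hdec
  have hU3 : ContDiff ℝ 3 U := hU.of_le (WithTop.coe_le_coe.2 le_top)
  have hP2 : ContDiff ℝ 2 P := hP.of_le (WithTop.coe_le_coe.2 le_top)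
  have hPC : ∀ y : EuclideanSpace ℝ (Fin 3), |P y| ≤ M * (1 + ‖y‖) ^ 0 := fun y => by
    rw [pow_zero, mul_one]; exact hPM y
  have hUq : MemLp U 4 volume :=
    memLp_of_norm_mul_norm_le hU.continuous (R := 0) (fun y _ => hyU y) (by norm_num) (by simp)
  refine rotatedLerayProfile_eq_zero_of_trace_nonneg one_pos (by norm_num : (0 : ℝ) < 1 / 2) (α • rotGenL)
    (inner_smul_rotGenL_skew α) hU3 hP2 hdiv (rotatedProfile_eq_general heq) hUb hPC
    (by norm_num : (1 : ℝ≥0∞) ≤ 4) (by simp) hUq fun y => ?_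
  rw [traceCLM_smul_rotGenL_comp_fderiv]
  linarith [hsign y]

/-- **A nontrivial rotated Leray profile has co-rotating vertical vorticity somewhere** (contrapositive of T7): under the same
hypotheses with `U ≠ 0`, `α (curl U)₃ > 0` at some point. [cite: Tsai1998, Theorem 1 (the case α = 0)] -/
theorem exists_corotating_vorticity_of_ne_zero {α C₀ M : ℝ}
    {U : EuclideanSpace ℝ (Fin 3) → EuclideanSpace ℝ (Fin 3)} {P : EuclideanSpace ℝ (Fin 3) → ℝ}
    (hU : ContDiff ℝ (⊤ : ℕ∞) U) (hP : ContDiff ℝ (⊤ : ℕ∞) P) (hdiv : VectorCalculus.IsDivFree U)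
    (heq : ∀ y : EuclideanSpace ℝ (Fin 3),
      α • (rotGen (U y) - fderiv ℝ U y (rotGen y)) + (1 / 2 : ℝ) • U y + (1 / 2 : ℝ) • fderiv ℝ U y y
        - (Δ U) y + fderiv ℝ U y (U y) + gradient P y = 0)
    (hdec : ∀ y : EuclideanSpace ℝ (Fin 3), ‖U y‖ ≤ C₀ / (1 + ‖y‖))
    (hPM : ∀ y : EuclideanSpace ℝ (Fin 3), |P y| ≤ M) (hne : U ≠ 0) :
    ∃ y : EuclideanSpace ℝ (Fin 3), 0 < α * (curl U y) 2 := by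
  by_contra h
  push Not at h
  exact hne (rotatedLerayProfile_eq_zero_of_counterRotating hU hP hdiv heq hdec hPM h)

/-- **Co-rotation sphere rigidity on `ℝ³`.** If the vorticity of a rotated Leray profile (Type-I profile decay, bounded
pressure) never enters the OPEN co-rotation ball `B(αe₃, |α|)`, i.e. `2α (curl U)₃ ≤ |curl U|²` everywhere, then it lies on
the co-rotation sphere everywhere: `|curl U|² ≡ 2α (curl U)₃` (the gauged head is then a bounded subsolution, hence
constant, and its source `|curl U|² − 2α(curl U)₃` vanishes). [cite: Tsai1998, Lemma 5.1 and (1.7) (the case α = 0)] -/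
theorem rotatedLerayProfile_vorticity_on_corotationSphere {α C₀ M : ℝ}
    {U : EuclideanSpace ℝ (Fin 3) → EuclideanSpace ℝ (Fin 3)} {P : EuclideanSpace ℝ (Fin 3) → ℝ}
    (hU : ContDiff ℝ (⊤ : ℕ∞) U) (hP : ContDiff ℝ (⊤ : ℕ∞) P) (hdiv : VectorCalculus.IsDivFree U)
    (heq : ∀ y : EuclideanSpace ℝ (Fin 3),
      α • (rotGen (U y) - fderiv ℝ U y (rotGen y)) + (1 / 2 : ℝ) • U y + (1 / 2 : ℝ) • fderiv ℝ U y y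
        - (Δ U) y + fderiv ℝ U y (U y) + gradient P y = 0)
    (hdec : ∀ y : EuclideanSpace ℝ (Fin 3), ‖U y‖ ≤ C₀ / (1 + ‖y‖))
    (hPM : ∀ y : EuclideanSpace ℝ (Fin 3), |P y| ≤ M)
    (hball : ∀ y : EuclideanSpace ℝ (Fin 3), 2 * α * (curl U y) 2 ≤ ‖curl U y‖ ^ 2) :
    ∀ y : EuclideanSpace ℝ (Fin 3), ‖curl U y‖ ^ 2 = 2 * α * (curl U y) 2 := by
  obtain ⟨-, hUb, -⟩ := bounds_of_profile_decay hdec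
  have hU3 : ContDiff ℝ 3 U := hU.of_le (WithTop.coe_le_coe.2 le_top)
  have hP2 : ContDiff ℝ 2 P := hP.of_le (WithTop.coe_le_coe.2 le_top)
  have hUd : Differentiable ℝ U := hU.differentiable (by simp)
  have hPC : ∀ y : EuclideanSpace ℝ (Fin 3), |P y| ≤ M * (1 + ‖y‖) ^ 0 := fun y => by
    rw [pow_zero, mul_one]; exact hPM y
  have hcurl : ∀ y, ‖curl U y‖ ^ 2 = 2⁻¹ * frobeniusNormSq (spin U y) := fun y =>
    norm_curl_sq_eq_frobeniusNormSq_spin_holds U y (hUd y)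
  have hsrc' : ∀ y, (1 : ℝ) / 2 * frobeniusNormSq (spin U y) + 2 * 1 * traceCLM ((α • rotGenL).comp (fderiv ℝ U y)) =
      ‖curl U y‖ ^ 2 - 2 * α * (curl U y) 2 := fun y => by
    rw [traceCLM_smul_rotGenL_comp_fderiv, hcurl y]
    ring
  have hsrc : ∀ y, 0 ≤ (1 : ℝ) / 2 * frobeniusNormSq (spin U y) + 2 * 1 * traceCLM ((α • rotGenL).comp (fderiv ℝ U y)) :=
    fun y => by rw [hsrc' y]; linarith [hball y]
  obtain ⟨hzero, -⟩ := rotatedHead_source_eq_zero_of_nonneg one_pos (by norm_num : (0 : ℝ) < 1 / 2) (α • rotGenL)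
    (inner_smul_rotGenL_skew α) hU3 hP2 hdiv (rotatedProfile_eq_general heq) hUb hPC hsrc
  intro y
  have h := hzero y
  rw [hsrc' y] at h
  linarith

/-- **Co-rotation necessity in the relative-equilibrium vocabulary of the v1–v3 stub** (`β` for the v3 stub's `ω`, `e₃ × ·` written with
`Literature.Analysis.FluidPDE.cross (EuclideanSpace.single 2 1)`, envelope `(1+‖y‖)‖V y‖ ≤ C`, bounded `Q`): a relative
equilibrium `(V, Q)` of Leray's backward system in the frame rotating at angular velocity `β` about `e₃`, whose vertical
vorticity never co-rotates (`β (curl V)₃ ≤ 0` on `ℝ³`), is trivial. Joins the necessary conditions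
`relativeEquilibrium_eq_zero_of_omega_zero / _of_axisymmetric / _of_small / _of_sphereTangent` and the rotation window.
[cite: Tsai1998, Theorem 1 (the case β = 0)] -/
theorem relativeEquilibrium_eq_zero_of_counterRotating {β C : ℝ}
    {V : EuclideanSpace ℝ (Fin 3) → EuclideanSpace ℝ (Fin 3)} {Q : EuclideanSpace ℝ (Fin 3) → ℝ}
    (hV : ContDiff ℝ (⊤ : ℕ∞) V) (hQ : ContDiff ℝ (⊤ : ℕ∞) Q)
    (hdiv : VectorCalculus.IsDivFree V)
    (hEq : ∀ y : EuclideanSpace ℝ (Fin 3),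
        β • (cross (EuclideanSpace.single (2 : Fin 3) (1 : ℝ)) (V y)
              - fderiv ℝ V y (cross (EuclideanSpace.single (2 : Fin 3) (1 : ℝ)) y))
          + (1 / 2 : ℝ) • V y + (1 / 2 : ℝ) • fderiv ℝ V y y + convect V V y + gradient Q y
          = (Δ V) y)
    (hVb : ∀ y : EuclideanSpace ℝ (Fin 3), (1 + ‖y‖) * ‖V y‖ ≤ C)
    (hQb : ∀ y : EuclideanSpace ℝ (Fin 3), |Q y| ≤ C)
    (hsign : ∀ y : EuclideanSpace ℝ (Fin 3), β * (curl V y) 2 ≤ 0) : V = 0 := by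
  have hdec : ∀ y : EuclideanSpace ℝ (Fin 3), ‖V y‖ ≤ C / (1 + ‖y‖) := fun y => by
    have h1 : (0 : ℝ) < 1 + ‖y‖ := by positivity
    rw [le_div_iff₀ h1, mul_comm]
    exact hVb y
  have heq : ∀ y : EuclideanSpace ℝ (Fin 3),
      β • (rotGen (V y) - fderiv ℝ V y (rotGen y)) + (1 / 2 : ℝ) • V y + (1 / 2 : ℝ) • fderiv ℝ V y y
        - (Δ V) y + fderiv ℝ V y (V y) + gradient Q y = 0 := fun y => by
    have h := hEq y
    rw [cross_single_two_eq_rotGen, cross_single_two_eq_rotGen, convect_apply] at h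
    rw [← h]
    abel
  exact rotatedLerayProfile_eq_zero_of_counterRotating hV hQ hdiv heq hdec hQb hsign

end R3

end Summit.NavierStokesRegularity.NavierStokesRegularity.Theorems.CorkscrewProfile.Birth
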